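import Literature.AlgebraicGeometry.HodgeTheory.MoonenZarhinCaseFHodgeConjecture
import HarnessLib

/-!
# Hodge classes generated by divisors and pull-backs of Weil classes: Moonen–Zarhin 1999 Thm. 0.2 (2), case (f), third sentence

Family `hodge`, layer `Literature/AlgebraicGeometry/HodgeTheory`. Research context: cell `pub-hodge-ring2` (HONEST
FRAMING: research route conditional on HC_CM; not a corollary; Q11.4-sentence-2 already refuted in dim ≥ 3),
Literature lane, programme R32 (lit gen 63): the RING-GENERATION reading of the third sentence of Moonen–Zarhin's
Thm. 0.2 (2), left open by R31-E (`MoonenZarhinCaseFHodgeConjecture`, which read it only through the Hodge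
conjecture). Two definitions (a submodule and a predicate, both with bodies) and theorems; no named fact, nothing
admitted (D-0026); no hypothesis `HC_CM` anywhere.

PRINTED RESULT. B. Moonen, Yu. Zarhin, *Hodge classes on abelian varieties of low dimension*, Math. Ann. 315 (1999)
711–733 [held: `paper:arxiv-math_9901113`, TeX chunk p0001 L157–L162, proof chunk p0011 L13–L17]: Thm. 0.2 «(2)
Suppose we are in case (f). Then `Hg(X) = Hg(X_0) × Hg(X_1 × X_2)`. For every `n ≥ 1` the Hodge ring `B•(Xⁿ)` is
generated by the images of `B•(X_0ⁿ)` and `B•(X_1ⁿ × X_2ⁿ)`. In particular, `B•(X)` is generated by the divisor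
classes `D•(X)` together with the pull-backs of the Weil classes in `W_k ⊂ B²(X_1 × X_2)`.» Case (f): «`X` is
isogenous to a product `X_0 × X_1 × X_2`, where `X_0` is an elliptic curve, where `X_1` and `X_2` are as in (a)
[`X_1` an elliptic curve with complex multiplication by an imaginary quadratic field `k`, `X_2` a simple abelian
threefold with an embedding `k ↪ End⁰(X_2)`], and such that `X_0` and `X_1` are not isogenous.» With Thm. 0.1 (1)
for case (a): «the Hodge ring `B•(X)` is generated by the subalgebra `D•(X)` of divisor classes together with the
space of Weil classes `W_k ⊂ B²(X)`», and the shape of Thm. 0.2 (1): «write `W_{k,α} ⊂ B²(X)` for its image under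
the map `B²(X_1 × X_2) → B²(X)` induced by a surjective homomorphism `α : X → X_1 × X_2`». Proof in print
((5.12)): «Case (f) is easy. It was established in (5.9) and (5.10) that `Hg(X) = Hg(X_0) × Hg(X_1 × X_2)`. … The
rest of statement (2) of (0.2) readily follows.» — i.e. by the Künneth decomposition of the Hodge classes of
`X_0 × (X_1 × X_2)` into exterior products of Hodge classes of the factors.

WHAT IS TYPED AND PROVED (tree vocabulary: `divisorClassesSpan X N p = Dᵖ(X) ⊗ ℂ`, `divisorMonomials`,
`weilClassesOf Y ψ n d = W_K ⊗ ℂ`, `HodgeClassesProductSpan`, `IsDivisorGenerated`, `IsDivisorWeilGenerated`).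
* §1 `divisorWeilPullbackSpan π ψ n d p` — for a homomorphism `π : X ⟶ Y` of complex abelian varieties and the
  Weil plane `W = weilClassesOf Y ψ n d ⊆ H²ⁿ(Y(ℂ); ℂ)`, the subspace `Dᵖ(X) ⊗ ℂ + (Dᵖ⁻ⁿ(X) ⊗ ℂ) ∪ π^*W` of
  `H²ᵖ(X(ℂ); ℂ)`: the degree-`2p` elements of the subring of `H^{2•}(X(ℂ); ℂ)` generated by the divisor classes
  and `π^*W` that have AT MOST ONE factor from `π^*W`. `IsDivisorWeilPullbackGenerated π ψ n d`: every rational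
  `(p,p)`-class of `X` lies there, for every `p`. This is the tree's reading of «`B•(X)` is generated by `D•(X)`
  together with the pull-backs of the Weil classes» — a priori FINER than the printed sentence (monomials with
  two or more Weil factors are not used), and exactly what the Künneth argument of (5.12) yields; it implies the
  printed sentence as stated. API: divisor classes times pulled-back Weil classes lie in the span
  (`cupProduct_map_mem_divisorWeilPullbackSpan`), functoriality in `X` (`map_mem_divisorWeilPullbackSpan`:
  `f^*` carries the span for `π` into the span for `f ≫ π`), the case `π = 𝟙`
  (`IsDivisorWeilGenerated.isDivisorWeilPullbackGenerated_id`).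
* §2 transport: `IsDivisorWeilPullbackGenerated π ψ n d → IsDivisorWeilPullbackGenerated (f ≫ π) ψ n d` for `f`
  a quasi-retraction (`f ≫ g = [N]`, `N ≠ 0`), an isogeny, and for every `X'` isogenous to `X` (with the composite
  `X' → X → Y` as the map along which the Weil classes are pulled back) — van Geemen §3.6, Mumford §19.
* §3 **`isDivisorWeilPullbackGenerated_snd_of_productSpan`** — the Künneth step of (5.12) in general: if the Hodge
  classes of `X₀ × Y` are spanned by exterior products of Hodge classes of the factors (`HodgeClassesProductSpan`,
  the tree's rendering of `Hg(X₀ × Y) = Hg(X₀) × Hg(Y)`), `B•(X₀) = D•(X₀)` and `B•(Y) ⊆ D•(Y) + W`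
  (`IsDivisorWeilGenerated Y ψ n d`), then `B•(X₀ × Y) ⊆ D•(X₀ × Y) + D•(X₀ × Y) ∪ pr_Y^* W`.
* §4 **THM. 0.2 (2) CASE (f), THIRD SENTENCE, for `End⁰(X₂) = k`** (`isDivisorWeilPullbackGenerated_caseF_of_finrank_two`):
  `X₀`, `X₁` elliptic curves, `X₀ ≁ X₁`, `X₁` with `χ₁ ≫ χ₁ = -d` of multiplicity `1` at `μ₀ ∈ {± i√d}`; `X₂` a
  simple threefold with `dim_ℚ End⁰(X₂) = 2`, `φ ≫ φ = -d` of multiplicity `1` at `μ₀` (the embedding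
  `k = ℚ(√-d) ↪ End⁰(X₂)`, multiplicities `(2,1)`, normalized as in R30). Then every rational Hodge class of
  `X = X₀ × (X₂ × X₁)` is a complex combination of products of divisor classes and of (products of divisor classes)
  ∪ `pr^* w`, `w` in the Weil plane `W_k ⊗ ℂ` of the fourfold `(X₂ × X₁, φ × χ₁)`; the same for every `X'`
  isogenous to `X`, along `X' → X → X₂ × X₁` (`exists_isDivisorWeilPullbackGenerated_of_isIsogenous_caseF`).
  Inputs: sentences 1–2 as product span (R31/R31-E `hodgeClassesProductSpan_caseF_of_finrank_two`), Thm. 0.1 (1)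
  case (a1) `B•(X₂ × X₁) ⊆ D• + W_k` (R30 `isDivisorWeilGenerated_prod_cmCurve_of_unitaryTwoOne`), `B•(X₀) = D•`
  for a curve. The sub-case `End⁰(X₂)` a sextic CM field of (a) is NOT covered (no typed analogue of R30 there).
* §5 what the third sentence reduces the Hodge conjecture to (`IsDivisorWeilPullbackGenerated.hodgeConjectureFor`):
  `B•(X) ⊆ D• + D• ∪ π^*W` and `W ⊆` algebraic classes of `Y` give the Hodge conjecture for `X` (Lefschetz `(1,1)`,
  divisors times algebraic classes are algebraic on an abelian variety, pull-backs of algebraic classes are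
  algebraic — tree theorems); hence HC for case (f) from the algebraicity of the rational Weil classes of THE ONE
  pair `(X₂ × X₁, φ × χ₁)` (`hodgeConjectureFor_caseF_of_weilClassesOf`), sharper than R31-E's appeal to the named
  fact on all abelian fourfolds. Nothing is claimed about `D²(X) ≠ B²(X)`.

## References
* [MoonenZarhin1999LowDim] B. J. J. Moonen, Yu. G. Zarhin, Math. Ann. 315 (1999), 711–733; Thm. 0.2 (1)–(2), cases
  (e)/(f), Thm. 0.1 (1) case (a), §5 (5.3), (5.10), (5.12) (held: `paper:arxiv-math_9901113`, chunks p0001, p0009,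
  p0010, p0011). [cite: MoonenZarhin1999LowDim, Thm. 0.2 (2) with case (f)]
* [vanGeemen1994HodgeAV] B. van Geemen, *An introduction to the Hodge conjecture for abelian varieties*, LNM 1594
  (1994), §2.4–2.5 (the ring `D•`), §3.6–3.7 (isogenies), Thm. 6.12. [cite: vanGeemen1994HodgeAV, §2.4 and §3.6]
* [MumfordAV1970] D. Mumford, *Abelian Varieties* (1970), §19 (quasi-inverse of an isogeny, `[n]^*`).
  [cite: MumfordAV1970, §19 Remark p. 169]
* [HatcherAT2002] A. Hatcher, *Algebraic Topology* (2002), §3.2 Prop. 3.10 (naturality of `∪`), Thm. 3.11.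
  [cite: HatcherAT2002, §3.2 Prop. 3.10]
* [VoisinHodgeII2003] C. Voisin, *Hodge Theory and Complex Algebraic Geometry II*, Prop. 9.20 (products of
  algebraic classes). [cite: VoisinHodgeII2003, §9.2.4 Prop. 9.20]
-/

noncomputable section

open scoped TensorProduct
open CategoryTheory MonoidalCategory CartesianMonoidalCategory

namespace Literature.AlgebraicGeometry.HodgeTheory

open Literature.AlgebraicGeometry.Motives Literature.AlgebraicGeometry.Motives.HodgeStructure
open Literature.AlgebraicGeometry.ComplexMultiplication
open Literature.AlgebraicTopology.SingularHomology
open Literature.Barriers.HodgeConjecture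

/-! ### §1 The span of divisor classes and divisor classes times pulled-back Weil classes -/

section Span

variable {X X' Y : AbelianVariety ℂ}

/-- **`Dᵖ(X) ⊗ ℂ + (D^{p-n}(X) ⊗ ℂ) ∪ π^*(W_K ⊗ ℂ) ⊆ H²ᵖ(X(ℂ); ℂ)`** — for a homomorphism `π : X ⟶ Y` of complex
abelian varieties and the complexified Weil plane `weilClassesOf Y ψ n d = W_K ⊗ ℂ ⊆ H²ⁿ(Y(ℂ); ℂ)` of `(Y, ψ)`:
the `ℂ`-span of the divisor monomials of degree `p` of `X` and of the classes `u ∪ π^* w`, `u` a divisor monomial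
of `X` of degree `l` with `2l + 2n = 2p`, `w ∈ W_K ⊗ ℂ`. These are the degree-`2p` elements, with at most one Weil
factor, of the subring of `H^{2•}(X(ℂ); ℂ)` «generated by the divisor classes `D•(X)` together with the
pull-backs of the Weil classes in `W_k`» (Moonen–Zarhin Thm. 0.2 (2); in Thm. 0.2 (1) the pulled-back space is
written `W_{k,α}`, «its image under the map `B²(X_1 × X_2) → B²(X)` induced by a surjective homomorphism
`α : X → X_1 × X_2`»). A definition (nothing asserted). [cite: MoonenZarhin1999LowDim, Thm. 0.2 (1)–(2)]
[cite: vanGeemen1994HodgeAV, §2.4] -/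
def divisorWeilPullbackSpan (π : X ⟶ Y) (ψ : Y ⟶ Y) (n d p : ℕ) : Submodule ℂ (complexBetti X.X (2 * p)) :=
  divisorClassesSpan X.X X.dim p ⊔ Submodule.span ℂ
    {x | ∃ (l : ℕ) (h : 2 * l + 2 * n = 2 * p) (u : complexBetti X.X (2 * l)) (w : complexBetti Y.X (2 * n)),
      u ∈ divisorMonomials X.X X.dim l ∧ w ∈ weilClassesOf Y ψ n d ∧
        x = cupProduct h u (complexBetti.map π.hom.hom.hom (2 * n) w)}

/-- **`B•(X)` is generated by the divisor classes together with the pull-backs `π^* W_K` of the Weil classes of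
`(Y, ψ)`** — the tree's reading of the third sentence of Moonen–Zarhin Thm. 0.2 (2) (and of the ring statement of
Thm. 0.2 (1)): every rational class of Hodge type `(p,p)` in `H²ᵖ(X(ℂ); ℂ)` lies in
`divisorWeilPullbackSpan π ψ n d p = Dᵖ ⊗ ℂ + (D^{p-n} ⊗ ℂ) ∪ π^*(W_K ⊗ ℂ)`. A predicate on `(X, π, ψ, n, d)`
(definition, nothing asserted); with at most one Weil factor it is a priori finer than the printed «generated
by», which it implies. [cite: MoonenZarhin1999LowDim, Thm. 0.2 (1)–(2)] [cite: vanGeemen1994HodgeAV, §2.4] -/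
def IsDivisorWeilPullbackGenerated (π : X ⟶ Y) (ψ : Y ⟶ Y) (n d : ℕ) : Prop :=
  ∀ (p : ℕ) (c : complexBetti X.X (2 * p)), IsRationalClass c → IsOfHodgeType X.dim X.X (2 * p) p p c →
    c ∈ divisorWeilPullbackSpan π ψ n d p

/-- Unfolding of `IsDivisorWeilPullbackGenerated`. [cite: MoonenZarhin1999LowDim, Thm. 0.2 (2)] -/
theorem isDivisorWeilPullbackGenerated_iff (π : X ⟶ Y) (ψ : Y ⟶ Y) (n d : ℕ) :
    IsDivisorWeilPullbackGenerated π ψ n d ↔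
      ∀ (p : ℕ) (c : complexBetti X.X (2 * p)), IsRationalClass c → IsOfHodgeType X.dim X.X (2 * p) p p c →
        c ∈ divisorWeilPullbackSpan π ψ n d p :=
  Iff.rfl

/-- `Dᵖ(X) ⊗ ℂ ⊆ divisorWeilPullbackSpan π ψ n d p`. [cite: vanGeemen1994HodgeAV, §2.4] -/
theorem divisorClassesSpan_le_divisorWeilPullbackSpan (π : X ⟶ Y) (ψ : Y ⟶ Y) (n d p : ℕ) :
    divisorClassesSpan X.X X.dim p ≤ divisorWeilPullbackSpan π ψ n d p :=
  le_sup_left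

/-- **A divisor class times a pulled-back Weil class lies in the span**: for `u ∈ Dˡ(X) ⊗ ℂ` (any element of the
complexified divisor ring, not only a monomial) and `w ∈ W_K ⊗ ℂ`, `u ∪ π^* w ∈ divisorWeilPullbackSpan π ψ n d p`
(`2l + 2n = 2p`; bilinearity of `∪`). [cite: MoonenZarhin1999LowDim, Thm. 0.2 (2)] [cite: HatcherAT2002, §3.2 Prop. 3.10] -/
theorem cupProduct_map_mem_divisorWeilPullbackSpan (π : X ⟶ Y) {ψ : Y ⟶ Y} {n d l p : ℕ}
    (h : 2 * l + 2 * n = 2 * p) {u : complexBetti X.X (2 * l)} (hu : u ∈ divisorClassesSpan X.X X.dim l)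
    {w : complexBetti Y.X (2 * n)} (hw : w ∈ weilClassesOf Y ψ n d) :
    cupProduct h u (complexBetti.map π.hom.hom.hom (2 * n) w) ∈ divisorWeilPullbackSpan π ψ n d p := by
  refine Submodule.mem_sup_right ?_
  induction hu using Submodule.span_induction with
  | mem x hx => exact Submodule.subset_span ⟨l, h, x, w, hx, hw, rfl⟩
  | zero => rw [LinearMap.map_zero₂]; exact Submodule.zero_mem _
  | add a b _ _ ha hb => rw [LinearMap.map_add₂]; exact Submodule.add_mem _ ha hb
  | smul r a _ ha => rw [LinearMap.map_smul₂]; exact Submodule.smul_mem _ r ha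

/-- **Functoriality in `X`: `f^*(Dᵖ(X) + D(X) ∪ π^*W) ⊆ Dᵖ(X') + D(X') ∪ (f ≫ π)^*W`** for a homomorphism
`f : X' ⟶ X` (`f^*` is a ring homomorphism preserving rational `(1,1)`-classes, and `f^* π^* = (f ≫ π)^*`).
[cite: vanGeemen1994HodgeAV, §2.4 and §3.6] [cite: HatcherAT2002, §3.2 Prop. 3.10] -/
theorem map_mem_divisorWeilPullbackSpan (f : X' ⟶ X) (π : X ⟶ Y) {ψ : Y ⟶ Y} {n d p : ℕ}
    {x : complexBetti X.X (2 * p)} (hx : x ∈ divisorWeilPullbackSpan π ψ n d p) :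
    complexBetti.map f.hom.hom.hom (2 * p) x ∈ divisorWeilPullbackSpan (f ≫ π) ψ n d p := by
  have hXs : IsSmoothProjective X.dim X.X := AbelianVariety.isSmoothProjective_holds
  have hX's : IsSmoothProjective X'.dim X'.X := AbelianVariety.isSmoothProjective_holds
  obtain ⟨a, ha, s, hs, rfl⟩ := Submodule.mem_sup.1 hx
  clear hx
  rw [map_add]
  refine Submodule.add_mem _ (Submodule.mem_sup_left (AbelianVariety.map_mem_divisorClassesSpan f ha))
    (Submodule.mem_sup_right ?_)
  induction hs using Submodule.span_induction with
  | mem y hy =>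
    obtain ⟨l, h, u, w, hu, hw, rfl⟩ := hy
    refine Submodule.subset_span ⟨l, h, complexBetti.map f.hom.hom.hom (2 * l) u, w,
      map_mem_divisorMonomials hX's hXs f.hom.hom.hom hu, hw, ?_⟩
    rw [cupProduct_map _ h, abelianVarietyHom_map_map_apply f π w]
  | zero => rw [map_zero]; exact Submodule.zero_mem _
  | add a b _ _ ha hb => rw [map_add]; exact Submodule.add_mem _ ha hb
  | smul r a _ ha => rw [map_smul]; exact Submodule.smul_mem _ r ha

/-- **The case `π = 𝟙`: `B•(Y) ⊆ D•(Y) + W_K` (van Geemen 6.12 / Thm. 0.1 (1), the tree's `IsDivisorWeilGenerated`)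
gives `IsDivisorWeilPullbackGenerated (𝟙 Y) ψ n d`** (`w = 1 ∪ 𝟙^* w`). [cite: vanGeemen1994HodgeAV, Thm. 6.12]
[cite: MoonenZarhin1999LowDim, Thm. 0.1 (1)] -/
theorem IsDivisorWeilGenerated.isDivisorWeilPullbackGenerated_id {ψ : Y ⟶ Y} {n d : ℕ}
    (hY : IsDivisorWeilGenerated Y ψ n d) : IsDivisorWeilPullbackGenerated (𝟙 Y) ψ n d := by
  intro p c hc hH
  by_cases hp : p = n
  · subst hp
    obtain ⟨a, ha, w, hw, rfl⟩ := Submodule.mem_sup.1 (hY.2 c hc hH)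
    refine Submodule.add_mem _ (Submodule.mem_sup_left ha) ?_
    have h1 : complexBetti.map (𝟙 Y : Y ⟶ Y).hom.hom.hom (2 * p) w = w := by
      change complexBetti.map (𝟙 Y.X) (2 * p) w = w
      rw [complexBetti.map_id]
      rfl
    have hw' : cupProduct (show 2 * 0 + 2 * p = 2 * p by ring) (singularCohomology.one ℂ (ComplexPoints Y.X))
        (complexBetti.map (𝟙 Y : Y ⟶ Y).hom.hom.hom (2 * p) w) = w := by
      rw [h1]
      exact one_cupProduct w
    have hmem := cupProduct_map_mem_divisorWeilPullbackSpan (𝟙 Y) (show 2 * 0 + 2 * p = 2 * p by ring)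
      (Submodule.subset_span (mem_divisorMonomials_zero.2 rfl)) hw
    rwa [hw'] at hmem
  · exact Submodule.mem_sup_left (hY.1 p c hp hc hH)

end Span

/-! ### §2 Transport along quasi-retractions and isogenies (van Geemen §3.6, Mumford §19) -/

section Transport

variable {X X' Y : AbelianVariety ℂ} {π : X ⟶ Y} {ψ : Y ⟶ Y} {n d : ℕ}

/-- **Transport along a quasi-retraction**: if `f : X' ⟶ X` and `g : X ⟶ X'` satisfy `f ≫ g = [N]` on `X'`
(`N ≠ 0`), then `IsDivisorWeilPullbackGenerated π ψ n d → IsDivisorWeilPullbackGenerated (f ≫ π) ψ n d`: for a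
rational `(p,p)`-class `c` of `X'`, `g^* c` is a rational `(p,p)`-class of `X`, so `N^{2p} c = f^* g^* c` lies in
`f^*(Dᵖ(X) + D(X) ∪ π^*W) ⊆ Dᵖ(X') + D(X') ∪ (f ≫ π)^*W`. [cite: MumfordAV1970, §19 Remark p. 169]
[cite: vanGeemen1994HodgeAV, §3.6] -/
theorem IsDivisorWeilPullbackGenerated.comp_of_comp_eq_nsmul_id (h : IsDivisorWeilPullbackGenerated π ψ n d)
    {f : X' ⟶ X} {g : X ⟶ X'} {N : ℕ} (hN : N ≠ 0) (hfg : f ≫ g = N • 𝟙 X') :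
    IsDivisorWeilPullbackGenerated (f ≫ π) ψ n d := by
  intro p c hc hH
  have hgc := AbelianVariety.mapsTo_hodgeClasses g p ⟨hc, hH⟩
  have hm := map_mem_divisorWeilPullbackSpan f π (h p _ hgc.1 hgc.2)
  rw [complexBetti_map_map_of_comp_eq_nsmul_id hfg] at hm
  have hNp : ((N : ℂ) ^ (2 * p)) ≠ 0 := pow_ne_zero _ (Nat.cast_ne_zero.mpr hN)
  rw [show c = ((N : ℂ) ^ (2 * p))⁻¹ • (((N : ℂ) ^ (2 * p)) • c) by rw [smul_smul, inv_mul_cancel₀ hNp, one_smul]]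
  exact Submodule.smul_mem _ _ hm

/-- **Transport along an isogeny** `f : X' ⟶ X`: `IsDivisorWeilPullbackGenerated π ψ n d →
IsDivisorWeilPullbackGenerated (f ≫ π) ψ n d` (quasi-inverse `g`, `f ≫ g = [N]`, the tree's theorem
`AbelianVariety.IsIsogeny.exists_nsmul_inverse_holds`). [cite: MumfordAV1970, §19 Remark p. 169]
[cite: vanGeemen1994HodgeAV, §3.6] -/
theorem IsDivisorWeilPullbackGenerated.comp_of_isIsogeny (h : IsDivisorWeilPullbackGenerated π ψ n d)
    {f : X' ⟶ X} (hf : AbelianVariety.IsIsogeny f) : IsDivisorWeilPullbackGenerated (f ≫ π) ψ n d := by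
  obtain ⟨g, N, hN, hfg, -⟩ := AbelianVariety.IsIsogeny.exists_nsmul_inverse_holds hf
  exact h.comp_of_comp_eq_nsmul_id hN.ne' hfg

/-- **Every `X'` isogenous to `X`** has its Hodge classes generated by divisors and the Weil classes pulled back
along `X' → X → Y` («`X` is isogenous to a product …», the isogeny composed with the projection playing the
rôle of Moonen–Zarhin's surjection `α`). [cite: MoonenZarhin1999LowDim, Thm. 0.2 (1)–(2)]
[cite: vanGeemen1994HodgeAV, §3.6] -/
theorem IsDivisorWeilPullbackGenerated.exists_of_isIsogenous (h : IsDivisorWeilPullbackGenerated π ψ n d)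
    (hX' : AbelianVariety.IsIsogenous X' X) :
    ∃ f : X' ⟶ X, AbelianVariety.IsIsogeny f ∧ IsDivisorWeilPullbackGenerated (f ≫ π) ψ n d := by
  obtain ⟨f, hf⟩ := hX'
  exact ⟨f, hf, h.comp_of_isIsogeny hf⟩

end Transport

/-! ### §3 The Künneth step: `X₀ × Y` with `B•(X₀) = D•`, `B•(Y) ⊆ D• + W` and product span -/

section ProductSpan

variable {X₀ Y : AbelianVariety ℂ} {ψ : Y ⟶ Y} {n d : ℕ}

/-- **Moonen–Zarhin (5.12) in general form.** Let `X₀`, `Y` be complex abelian varieties such that the rational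
Hodge classes of `X₀ × Y` are spanned by exterior products `pr_{X₀}^* a ∪ pr_Y^* b` of rational Hodge classes of
the factors (`HodgeClassesProductSpan X₀ Y`, i.e. «`Hg(X) = Hg(X_0) × Hg(X_1 × X_2)`» read on classes),
`B•(X₀) = D•(X₀)` (`IsDivisorGenerated X₀`) and `B•(Y) ⊆ D•(Y) + W_K` off/in degree `2n`
(`IsDivisorWeilGenerated Y ψ n d`). Then every rational Hodge class of `X₀ × Y` lies in
`D•(X₀ × Y) ⊗ ℂ + (D•(X₀ × Y) ⊗ ℂ) ∪ pr_Y^*(W_K ⊗ ℂ)`: `pr_{X₀}^* a ∪ pr_Y^* b` with `a ∈ Dˡ(X₀)`, `b ∈ Dᵏ(Y)` is in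
`D^{l+k}(X₀ × Y)`, and with `b ∈ W_K` it is `(pr_{X₀}^* a) ∪ pr_Y^* b` with `pr_{X₀}^* a ∈ Dˡ(X₀ × Y)`.
[cite: MoonenZarhin1999LowDim, Thm. 0.2 (2) and §5 (5.12)] [cite: vanGeemen1994HodgeAV, §2.4] -/
theorem isDivisorWeilPullbackGenerated_snd_of_productSpan (hS : HodgeClassesProductSpan X₀ Y)
    (hX₀ : IsDivisorGenerated X₀) (hY : IsDivisorWeilGenerated Y ψ n d) :
    IsDivisorWeilPullbackGenerated (AbelianVariety.snd X₀ Y) ψ n d := by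
  intro p c hc hH
  rw [AbelianVariety.dim_prod] at hH
  refine (Submodule.span_le.2 ?_) (hS p c hc hH)
  rintro x ⟨l, k, hlk, a, b, ha, ha', hb, hb', rfl⟩
  have hfa : complexBetti.map (fst X₀.X Y.X) (2 * l) a ∈ divisorClassesSpan (X₀.prod Y).X (X₀.prod Y).dim l :=
    AbelianVariety.map_mem_divisorClassesSpan (AbelianVariety.fst X₀ Y) (hX₀ l a ha ha')
  by_cases hk : k = n
  · subst hk
    obtain ⟨b₁, hb₁, b₂, hb₂, rfl⟩ := Submodule.mem_sup.1 (hY.2 b hb hb')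
    rw [map_add, map_add]
    exact Submodule.add_mem _
      (Submodule.mem_sup_left (cupProduct_mem_divisorClassesSpan_of_mem (by omega) hlk hfa
        (AbelianVariety.map_mem_divisorClassesSpan (AbelianVariety.snd X₀ Y) hb₁)))
      (cupProduct_map_mem_divisorWeilPullbackSpan (AbelianVariety.snd X₀ Y) hlk hfa hb₂)
  · exact Submodule.mem_sup_left (cupProduct_mem_divisorClassesSpan_of_mem (by omega) hlk hfa
      (AbelianVariety.map_mem_divisorClassesSpan (AbelianVariety.snd X₀ Y) (hY.1 k b hk hb hb')))

/-- The same for every `X` isogenous to `X₀ × Y`, along `X → X₀ × Y → Y`.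
[cite: MoonenZarhin1999LowDim, Thm. 0.2 (2) and §5 (5.12)] [cite: vanGeemen1994HodgeAV, §3.6] -/
theorem exists_isDivisorWeilPullbackGenerated_of_isIsogenous_prod_of_productSpan {X : AbelianVariety ℂ}
    (hX : AbelianVariety.IsIsogenous X (X₀.prod Y)) (hS : HodgeClassesProductSpan X₀ Y)
    (hX₀ : IsDivisorGenerated X₀) (hY : IsDivisorWeilGenerated Y ψ n d) :
    ∃ f : X ⟶ X₀.prod Y, AbelianVariety.IsIsogeny f ∧
      IsDivisorWeilPullbackGenerated (f ≫ AbelianVariety.snd X₀ Y) ψ n d :=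
  (isDivisorWeilPullbackGenerated_snd_of_productSpan hS hX₀ hY).exists_of_isIsogenous hX

end ProductSpan

/-! ### §4 Moonen–Zarhin Thm. 0.2 (2), case (f) with `End⁰(X₂) = k`: the third sentence -/

section CaseF

variable {X₀ X₁ X₂ : AbelianVariety ℂ}

/-- **THM. 0.2 (2), CASE (f) with `End⁰(X₂) = k`, THIRD SENTENCE** («In particular, `B•(X)` is generated by the
divisor classes `D•(X)` together with the pull-backs of the Weil classes in `W_k ⊂ B²(X_1 × X_2)`»), for
`X = X₀ × (X₂ × X₁)`. Hypotheses: `X₀`, `X₁` elliptic curves, «`X_0` and `X_1` are not isogenous»; `X₂` a simple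
abelian threefold with `End⁰(X₂) = k = ℚ(√-d)` (`dim_ℚ End⁰(X₂) = 2`, `φ ≫ φ = -d`) acting with multiplicities
`(2,1)` (multiplicity `1` at `μ₀ ∈ {± i√d}`), and `X₁` with complex multiplication `χ₁ ≫ χ₁ = -d` by the same `k`,
of multiplicity `1` at `μ₀` (the embedding `k ↪ End⁰(X_2)` of case (a), normalized as in the tree's R30). Then
every rational Hodge class of `X` lies in `D•(X) ⊗ ℂ + (D•(X) ⊗ ℂ) ∪ pr^*(W_k ⊗ ℂ)`, `W_k ⊗ ℂ = weilClassesOf` of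
the Weil-type fourfold `(X₂ × X₁, φ × χ₁)`. Proof = (5.12): sentences 1–2 as product span
(`hodgeClassesProductSpan_caseF_of_finrank_two`, moved to `X₂ × X₁` by isogeny invariance), `B•(X₀) = D•(X₀)` for
a curve, `B•(X₂ × X₁) ⊆ D• + W_k` (Thm. 0.1 (1) case (a1), the tree's
`isDivisorWeilGenerated_prod_cmCurve_of_unitaryTwoOne`), and §3. The sub-case of (a) with `End⁰(X₂)` a sextic CM
field is not covered. [cite: MoonenZarhin1999LowDim, Thm. 0.2 (2) with case (f), §5 (5.12)]
[cite: MoonenZarhin1999LowDim, Thm. 0.1 (1) with case (a)] -/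
theorem isDivisorWeilPullbackGenerated_caseF_of_finrank_two (hX₀ : X₀.dim = 1) (hX₁ : X₁.dim = 1)
    (hni : ¬ AbelianVariety.IsIsogenous X₀ X₁) (hX₂ : X₂.IsSimple) (hX₂3 : X₂.dim = 3)
    (h2 : Module.finrank ℚ X₂.endAlgebra = 2) (φ : X₂ ⟶ X₂) {d : ℕ} (hd : 0 < d) (hφ : φ ≫ φ = -(d • 𝟙 X₂))
    {μ₀ : ℂ} (hμ₀ : μ₀ = Complex.I * (Real.sqrt d : ℂ) ∨ μ₀ = -(Complex.I * (Real.sqrt d : ℂ)))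
    (hm₂ : eigenMultiplicity X₂ φ μ₀ = 1) (χ₁ : X₁ ⟶ X₁) (hχ₁ : χ₁ ≫ χ₁ = -(d • 𝟙 X₁))
    (hm₁ : eigenMultiplicity X₁ χ₁ μ₀ = 1) :
    IsDivisorWeilPullbackGenerated (AbelianVariety.snd X₀ (X₂.prod X₁))
      (AbelianVariety.prodLift (AbelianVariety.fst X₂ X₁ ≫ φ) (AbelianVariety.snd X₂ X₁ ≫ χ₁)) 2 d :=
  isDivisorWeilPullbackGenerated_snd_of_productSpan
    ((hodgeClassesProductSpan_caseF_of_finrank_two hX₀ hX₁ hni χ₁ hd hχ₁ hX₂ (by omega) h2 φ hφ).of_isIsogenous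
      (AbelianVariety.IsIsogenous.refl X₀) (isIsogenous_prod_swap X₂ X₁))
    (EllipticCurve.isStablyNondegenerate hX₀).isDivisorGenerated
    (isDivisorWeilGenerated_prod_cmCurve_of_unitaryTwoOne hX₂3 h2 φ hd hφ hμ₀ hm₂ hX₁ χ₁ hχ₁ hm₁)

/-- **Case (f) as printed — «`X` is isogenous to a product `X_0 × X_1 × X_2`»**: for every `X` isogenous to
`X₀ × (X₁ × X₂)` as above there is an isogeny `f : X → X₀ × (X₂ × X₁)` such that every rational Hodge class of
`X` lies in `D•(X) ⊗ ℂ + (D•(X) ⊗ ℂ) ∪ α^*(W_k ⊗ ℂ)` for the surjection `α = f ≫ pr : X → X₂ × X₁` (§2 transport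
along the isogeny). [cite: MoonenZarhin1999LowDim, Thm. 0.2 (2) with case (f)] [cite: vanGeemen1994HodgeAV, §3.6] -/
theorem exists_isDivisorWeilPullbackGenerated_of_isIsogenous_caseF {X : AbelianVariety ℂ}
    (hX : AbelianVariety.IsIsogenous X (X₀.prod (X₁.prod X₂))) (hX₀ : X₀.dim = 1) (hX₁ : X₁.dim = 1)
    (hni : ¬ AbelianVariety.IsIsogenous X₀ X₁) (hX₂ : X₂.IsSimple) (hX₂3 : X₂.dim = 3)
    (h2 : Module.finrank ℚ X₂.endAlgebra = 2) (φ : X₂ ⟶ X₂) {d : ℕ} (hd : 0 < d) (hφ : φ ≫ φ = -(d • 𝟙 X₂))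
    {μ₀ : ℂ} (hμ₀ : μ₀ = Complex.I * (Real.sqrt d : ℂ) ∨ μ₀ = -(Complex.I * (Real.sqrt d : ℂ)))
    (hm₂ : eigenMultiplicity X₂ φ μ₀ = 1) (χ₁ : X₁ ⟶ X₁) (hχ₁ : χ₁ ≫ χ₁ = -(d • 𝟙 X₁))
    (hm₁ : eigenMultiplicity X₁ χ₁ μ₀ = 1) :
    ∃ f : X ⟶ X₀.prod (X₂.prod X₁), AbelianVariety.IsIsogeny f ∧
      IsDivisorWeilPullbackGenerated (f ≫ AbelianVariety.snd X₀ (X₂.prod X₁))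
        (AbelianVariety.prodLift (AbelianVariety.fst X₂ X₁ ≫ φ) (AbelianVariety.snd X₂ X₁ ≫ χ₁)) 2 d :=
  (isDivisorWeilPullbackGenerated_caseF_of_finrank_two hX₀ hX₁ hni hX₂ hX₂3 h2 φ hd hφ hμ₀ hm₂ χ₁ hχ₁
      hm₁).exists_of_isIsogenous
    (hX.trans ((AbelianVariety.IsIsogenous.refl X₀).prod (isIsogenous_prod_swap X₁ X₂)))

end CaseF

/-! ### §5 What the third sentence reduces the Hodge conjecture to -/

section HodgeConjecture

variable {X Y : AbelianVariety ℂ} {π : X ⟶ Y} {ψ : Y ⟶ Y} {n d : ℕ}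

/-- **An algebraic class times a divisor monomial is algebraic** on a complex abelian variety: `x ∪ (b₁ ∪ ⋯ ∪ b_l)`
with `x ∈ Nᵏ H²ᵏ` algebraic and `bᵢ` rational `(1,1)`-classes lies in `N^{k+l} H^{2k+2l}` (Lefschetz `(1,1)`, the
tree's `lefschetzOneOne_rational_holds`, and «`cl(Z · D) = cl(Z) ∪ cl(D)`» on an abelian variety, the tree's
`AbelianVariety.cupProduct_mem_algebraicClasses_one`, one divisor at a time by associativity of `∪`).
[cite: VoisinHodgeII2003, §9.2.4 Prop. 9.20] [cite: vanGeemen1994HodgeAV, §2.4] -/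
theorem cupProduct_mem_algebraicClasses_of_mem_divisorMonomials_right (X : AbelianVariety ℂ) :
    ∀ {l k p : ℕ} (h : 2 * k + 2 * l = 2 * p) {x : complexBetti X.X (2 * k)} (_ : x ∈ algebraicClasses X.X k)
      {u : complexBetti X.X (2 * l)} (_ : u ∈ divisorMonomials X.X X.dim l),
      cupProduct h x u ∈ algebraicClasses X.X p
  | 0, k, p, h, x, hx, u, hu => by
    obtain rfl : p = k := by omega
    rw [mem_divisorMonomials_zero] at hu
    subst hu
    have h1 : cupProduct h x (singularCohomology.one ℂ (ComplexPoints X.X)) = x := cupProduct_one x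
    rw [h1]
    exact hx
  | l + 1, k, p, h, x, hx, u, hu => by
    obtain ⟨u', hu', b, hb, hb', rfl⟩ := mem_divisorMonomials_succ.1 hu
    obtain rfl : p = k + l + 1 := by omega
    rw [← cupProduct_assoc (show 2 * k + 2 * l = 2 * (k + l) by ring) (show 2 * l + 2 = 2 * (l + 1) by ring)
      (show 2 * (k + l) + 2 = 2 * (k + l + 1) by ring) h]
    exact AbelianVariety.cupProduct_mem_algebraicClasses_one X
      (cupProduct_mem_algebraicClasses_of_mem_divisorMonomials_right X _ hx hu')
      (lefschetzOneOne_rational_holds (AbelianVariety.isSmoothProjective_holds (A := X)) b hb hb')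

/-- **A divisor monomial times an algebraic class is algebraic** on a complex abelian variety (the previous
result and graded commutativity of `∪` in even degrees, Hatcher Thm. 3.11, the tree's `cupProduct_gradedComm_holds`).
[cite: VoisinHodgeII2003, §9.2.4 Prop. 9.20] [cite: HatcherAT2002, §3.2 Thm. 3.11] -/
theorem cupProduct_mem_algebraicClasses_of_mem_divisorMonomials_left (X : AbelianVariety ℂ) {l k p : ℕ}
    (h : 2 * l + 2 * k = 2 * p) {u : complexBetti X.X (2 * l)} (hu : u ∈ divisorMonomials X.X X.dim l)
    {x : complexBetti X.X (2 * k)} (hx : x ∈ algebraicClasses X.X k) :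
    cupProduct h u x ∈ algebraicClasses X.X p := by
  rw [cupProduct_gradedComm_holds ℂ (ComplexPoints X.X) h (show 2 * k + 2 * l = 2 * p by omega) u x,
    show 2 * l * (2 * k) = 2 * (l * (2 * k)) by ring, pow_mul, neg_one_sq, one_pow, one_smul]
  exact cupProduct_mem_algebraicClasses_of_mem_divisorMonomials_right X _ hx hu

/-- **`B•(X) ⊆ D• + D• ∪ π^*W_K` and `W_K ⊗ ℂ ⊆` algebraic classes of `Y` give the Hodge conjecture for `X`**
(in the tree's form `HodgeConjectureFor X.dim X.X`): divisor polynomials are algebraic (Lefschetz `(1,1)` and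
products, the tree's `AbelianVariety.divisorClassesSpan_le_algebraicClasses`), `π^* w` is algebraic for `w`
algebraic (the tree's `map_mem_algebraicClasses_of_abelianVariety`), and a divisor monomial times an algebraic
class is algebraic. This is what the third sentence of Thm. 0.2 (2) reduces the Hodge conjecture for `X` to: the
Weil classes of `(Y, ψ)`. [cite: MoonenZarhin1999LowDim, Thm. 0.2 (2)] [cite: vanGeemen1994HodgeAV, §2.4 and Thm. 6.12] -/
theorem IsDivisorWeilPullbackGenerated.hodgeConjectureFor (h : IsDivisorWeilPullbackGenerated π ψ n d)
    (hW : weilClassesOf Y ψ n d ≤ algebraicClasses Y.X n) : HodgeConjectureFor X.dim X.X := by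
  have hXs : IsSmoothProjective X.dim X.X := AbelianVariety.isSmoothProjective_holds
  refine ⟨nonempty_hodgeModel_holds hXs, fun p c hc hH => ?_⟩
  obtain ⟨a, ha, s, hs, rfl⟩ := Submodule.mem_sup.1 (h p c hc hH)
  refine Submodule.add_mem _
    (AbelianVariety.divisorClassesSpan_le_algebraicClasses X
      (fun b hb hb' => lefschetzOneOne_rational_holds hXs b hb hb') p ha)
    ((Submodule.span_le.2 ?_) hs)
  rintro x ⟨l, hl, u, w, hu, hw, rfl⟩
  exact cupProduct_mem_algebraicClasses_of_mem_divisorMonomials_left X hl hu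
    (map_mem_algebraicClasses_of_abelianVariety hXs Y π.hom.hom.hom (hW hw))

variable {X₀ X₁ X₂ : AbelianVariety ℂ}

/-- **The Hodge conjecture for `X₀ × (X₂ × X₁)` in case (f) with `End⁰(X₂) = k`, from the algebraicity of the
rational Weil classes of THE ONE Weil-type fourfold `(X₂ × X₁, φ × χ₁)`** (hypothesis `hW`: every rational
`(2,2)`-class in `weilClassesOf (X₂ × X₁) (φ × χ₁) 2 d` is algebraic — the `(X₂ × X₁, φ × χ₁)`-slice of «Weil
classes are algebraic»; the complexified plane then consists of algebraic classes since `(X₂ × X₁, φ × χ₁)` is of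
Weil type `(2, d)`, the tree's `isWeilType_prod_cmCurve_of_unitaryTwoOne` and
`IsWeilType.weilClassesOf_le_algebraicClasses`). Sharper than the tree's
`hodgeConjectureFor_caseF_of_weilClassesFourfold` (R31-E), which assumes the named fact on ALL abelian fourfolds.
[cite: MoonenZarhin1999LowDim, Thm. 0.2 (2) with case (f)] [cite: vanGeemen1994HodgeAV, Thm. 6.12 and 4.11] -/
theorem hodgeConjectureFor_caseF_of_weilClassesOf (hX₀ : X₀.dim = 1) (hX₁ : X₁.dim = 1)
    (hni : ¬ AbelianVariety.IsIsogenous X₀ X₁) (hX₂ : X₂.IsSimple) (hX₂3 : X₂.dim = 3)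
    (h2 : Module.finrank ℚ X₂.endAlgebra = 2) (φ : X₂ ⟶ X₂) {d : ℕ} (hd : 0 < d) (hφ : φ ≫ φ = -(d • 𝟙 X₂))
    {μ₀ : ℂ} (hμ₀ : μ₀ = Complex.I * (Real.sqrt d : ℂ) ∨ μ₀ = -(Complex.I * (Real.sqrt d : ℂ)))
    (hm₂ : eigenMultiplicity X₂ φ μ₀ = 1) (χ₁ : X₁ ⟶ X₁) (hχ₁ : χ₁ ≫ χ₁ = -(d • 𝟙 X₁))
    (hm₁ : eigenMultiplicity X₁ χ₁ μ₀ = 1)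
    (hW : ∀ c ∈ weilClassesOf (X₂.prod X₁)
        (AbelianVariety.prodLift (AbelianVariety.fst X₂ X₁ ≫ φ) (AbelianVariety.snd X₂ X₁ ≫ χ₁)) 2 d,
      IsRationalClass c → IsOfHodgeType (2 * 2) (X₂.prod X₁).X (2 * 2) 2 2 c →
        c ∈ algebraicClasses (X₂.prod X₁).X 2) :
    HodgeConjectureFor (X₀.prod (X₂.prod X₁)).dim (X₀.prod (X₂.prod X₁)).X :=
  (isDivisorWeilPullbackGenerated_caseF_of_finrank_two hX₀ hX₁ hni hX₂ hX₂3 h2 φ hd hφ hμ₀ hm₂ χ₁ hχ₁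
      hm₁).hodgeConjectureFor
    ((isWeilType_prod_cmCurve_of_unitaryTwoOne hX₂3 φ hd hφ hμ₀ hm₂ hX₁ χ₁ hχ₁ hm₁).weilClassesOf_le_algebraicClasses
      hW)

/-- … and for every `X` isogenous to `X₀ × (X₁ × X₂)` (the Hodge conjecture is isogeny invariant, van Geemen
Lemma 3.7, the tree's `HodgeConjectureFor.of_isIsogenous`). [cite: MoonenZarhin1999LowDim, Thm. 0.2 (2) with case (f)]
[cite: vanGeemen1994HodgeAV, Lemma 3.7] -/
theorem hodgeConjectureFor_of_isIsogenous_caseF_of_weilClassesOf {X : AbelianVariety ℂ}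
    (hX : AbelianVariety.IsIsogenous X (X₀.prod (X₁.prod X₂))) (hX₀ : X₀.dim = 1) (hX₁ : X₁.dim = 1)
    (hni : ¬ AbelianVariety.IsIsogenous X₀ X₁) (hX₂ : X₂.IsSimple) (hX₂3 : X₂.dim = 3)
    (h2 : Module.finrank ℚ X₂.endAlgebra = 2) (φ : X₂ ⟶ X₂) {d : ℕ} (hd : 0 < d) (hφ : φ ≫ φ = -(d • 𝟙 X₂))
    {μ₀ : ℂ} (hμ₀ : μ₀ = Complex.I * (Real.sqrt d : ℂ) ∨ μ₀ = -(Complex.I * (Real.sqrt d : ℂ)))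
    (hm₂ : eigenMultiplicity X₂ φ μ₀ = 1) (χ₁ : X₁ ⟶ X₁) (hχ₁ : χ₁ ≫ χ₁ = -(d • 𝟙 X₁))
    (hm₁ : eigenMultiplicity X₁ χ₁ μ₀ = 1)
    (hW : ∀ c ∈ weilClassesOf (X₂.prod X₁)
        (AbelianVariety.prodLift (AbelianVariety.fst X₂ X₁ ≫ φ) (AbelianVariety.snd X₂ X₁ ≫ χ₁)) 2 d,
      IsRationalClass c → IsOfHodgeType (2 * 2) (X₂.prod X₁).X (2 * 2) 2 2 c →
        c ∈ algebraicClasses (X₂.prod X₁).X 2) :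
    HodgeConjectureFor X.dim X.X :=
  HodgeConjectureFor.of_isIsogenous
    (hX.trans ((AbelianVariety.IsIsogenous.refl X₀).prod (isIsogenous_prod_swap X₁ X₂)))
    (hodgeConjectureFor_caseF_of_weilClassesOf hX₀ hX₁ hni hX₂ hX₂3 h2 φ hd hφ hμ₀ hm₂ χ₁ hχ₁ hm₁ hW)

end HodgeConjecture

/- **On path**: the Hodge conjecture gives every Hodge-conjecture statement of this file (the tree's
`hodgeConjectureFor_prod_of_hodgeConjecture'`); §5 reduces it, in case (f) with `End⁰(X₂) = k`, to the Weil
classes of one Weil-type fourfold. -/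
example (h : ∀ ⦃n : ℕ⦄ ⦃X : Motives.SchemeOver ℂ⦄, Motives.IsSmoothProjective n X → HodgeConjectureFor n X)
    (X₀ X₁ X₂ : AbelianVariety ℂ) : HodgeConjectureFor (X₀.prod (X₂.prod X₁)).dim (X₀.prod (X₂.prod X₁)).X :=
  hodgeConjectureFor_prod_of_hodgeConjecture' h X₀ (X₂.prod X₁)

end Literature.AlgebraicGeometry.HodgeTheory
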